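import Summits.QuantumFields.BalabanUV.T4Continuum.Support.VariationalVectorFeynmanRegularityRho
import Summits.QuantumFields.BalabanUV.T4Continuum.Support.VariationalVectorEndOfLeavesE
import Summits.QuantumFields.BalabanUV.T4Continuum.Support.VariationalVectorGaugeSliceTower

/-!
# T⁴ programme, spine node NE2 (U1a), lane P2 — SUPPLIER ITEM «V-END-E FEYNMAN, REG DISCHARGED»: leaf-10-g3's general-`E` vector END
# `towerLimitRate_effVE_of_leaves` (p222482) AT THE FEYNMAN INHABITANT `G k := landauG 1 (R k)` WITH THE `hREG k` SOCKET DISCHARGED by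
# `VariationalVectorFeynmanRegularityRho.hREG_rhoV` (p223070) — the flattened divergence Gram matrix supplies `hGm`∕`hG`, the pullback supplies `hGtr`
# (the general-`E` counterpart of leaf-03-g5's `E = ℂ` (D) for the Landau END; model level; cell `pub-balaban`)

NE2 formalisation swarm `b2b-balaban-t4-ne2-formalise-*`, leaf prover 02 (gen 5); register P2-sup.  COMPOSITION ONLY:
 * §1 `divLinE R` (the covariant divergence as a ℂ-linear map of the uncurried 1-form), **`GmDiv b R := (matE b (divLinE R))ᴴ·matE b (divLinE R)`** (PSD,
   `GmDiv_posSemidef`) and **`landauG_one_eq_qformE`**: `landauG 1 R W = qform (GmDiv b R) (flatE b (uncV W))` (D-E part 1's `sum_norm_sq_eq_qform_gram`);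
 * §2 **`towerLimitRate_effVE_of_leaves_feynman`**: p222482 with `G k := landauG 1 (R k)`, `Gm k := GmDiv b (R k)`, `G′ k :=` the pullback of `G (k+1)` along
   `sites` (`hGtr` by leaf-09-g7's `Gtr_pullback`), `ρV k := rhoV (L^k) M (R k)` and **`hREG k` DISCHARGED** by `hREG_rhoV` with
   `C_R k = 4Λ_k + 2d(p_k n_k²) + 7d²(p_k n_k²)²·C_P,k ≤ C_R⋆ := 4Λ⋆ + 2d·c_p + 7d²c_p²·C_P⋆` under the plaquette class `p_k·n_k² ≤ c_p` (UNITARY `R k`,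
   CONTRACTIVE line transports `T k`); displayed as in p222482: V-UB (`hUBc`, `hUBf`), V-P (`hPc`, `hPf`), V-FED (`hFED`), V-ONE (`hONE`), `hsurj₁`, the uniform
   bounds and decay.  NO multiplier, NO NE3.

HONEST FRAMING (T4-DAG p. 1).  Model level (operators ∕ line transports DATA, c5); the Feynman inhabitant `landauG 1` is the tree's typed inhabitant of the gauge
slot, NOT Bałaban's `G` ([B9] (3.26)); whether the END should run at this `G` is V-GF's question (leaf-09 ∕ leaf-01 lineages).  [folklore] plumbing; nothing
printed is a hypothesis; data defs `divLinE`, `GmDiv` only, no `def … : Prop`; no `sorry`; axioms standard.  V-END ∕ NE2 NOT proved; NE3 untouched; spine PROVED 0∕9;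
rung (B)+1 finite T⁴ — NOT infinite volume, NOT a mass gap, NOT Clay.  HONEST DEPENDENCY (cell, verbatim): continuum YM on T⁴ ⇐ BetaPertH ∧ nine spine estimates
(0/9 proved); BetaPertH ⇐ (D1) ∧ (D4) ∧ CAP+tail; G-an2-4 gates asym, D1 and NE2/3/4.
-/

noncomputable section

namespace Summit.QuantumFields.BalabanUV.T4Continuum.VariationalVectorFeynmanEnd

open Finset
open scoped Matrix ComplexOrder
open Literature.MathematicalPhysics.QuantumFieldTheory.Balaban1983to89.B5Prop11Plancherel (Tor fine unitVec)
open Literature.MathematicalPhysics.QuantumFieldTheory.Balaban1983to89.B5Composition116 (sites)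
open Literature.Analysis.Complex (qform)
open Summit.QuantumFields.BalabanUV.T4Continuum.VariationalTransfer (blockSpin)
open Summit.QuantumFields.BalabanUV.T4Continuum.VariationalColourTower (Rtrv)
open Summit.QuantumFields.BalabanUV.T4Continuum.CovariantAveragingTower (TowerLimitRate)
open Summit.QuantumFields.BalabanUV.T4Continuum.VectorBlockTrialForm (nsqV nsqV_nonneg QvL compL)
open Summit.QuantumFields.BalabanUV.T4Continuum.VariationalVectorForm (ScV SfV qWV qVV)
open Summit.QuantumFields.BalabanUV.T4Continuum.VariationalVectorWeitzenbock (divV divSq)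
open Summit.QuantumFields.BalabanUV.T4Continuum.VariationalVectorGarding (landauG)
open Summit.QuantumFields.BalabanUV.T4Continuum.VariationalVectorTower (Gtr)
open Summit.QuantumFields.BalabanUV.T4Continuum.VariationalVectorGaugeSliceTower (Gtr_pullback)
open Summit.QuantumFields.BalabanUV.T4Continuum.VariationalEffectiveHilbert (flatE matE sum_norm_sq_eq_qform_gram)
open Summit.QuantumFields.BalabanUV.T4Continuum.VariationalEffectiveHilbertVector (uncV curV curV_uncV effVE)
open Summit.QuantumFields.BalabanUV.T4Continuum.VariationalVectorOneStepPhys (rhoV rhoV_nonneg)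
open Summit.QuantumFields.BalabanUV.T4Continuum.VariationalVectorFeynmanForm (divV_add divV_smul)
open Summit.QuantumFields.BalabanUV.T4Continuum.VariationalVectorFeynmanRegularityRho (hREG_rhoV)
open Summit.QuantumFields.BalabanUV.T4Continuum.VariationalVectorEndOfLeaves (eV ePV towerLimitRate_effVE_of_leaves)

variable {d : ℕ} {E : Type*} [NormedAddCommGroup E] [InnerProductSpace ℂ E] [CompleteSpace E]
variable {κ : Type*} [Fintype κ] [DecidableEq κ]

/-! ## §1 The flattened divergence Gram matrix: `landauG 1 R = qform (GmDiv b R) ∘ flatE b ∘ uncV` -/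

section Gram

variable (N : Fin d → ℕ) [∀ μ, NeZero (N μ)]

/-- the covariant divergence as a ℂ-linear map of the uncurried 1-form. [folklore] -/
def divLinE (R : Tor N → Fin d → (E →L[ℂ] E)) : (Tor N × Fin d → E) →ₗ[ℂ] (Tor N → E) where
  toFun w := divV N R (curV w)
  map_add' w w' := by
    have h : curV (d := d) (w + w') = curV w + curV w' := rfl
    rw [h, divV_add]
  map_smul' c w := by
    have h : curV (d := d) (c • w) = c • curV w := rfl
    rw [h, divV_smul]; rfl

/-- **the divergence Gram matrix** on the flattened index `(Tor N × Fin d) × κ`. [folklore] -/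
def GmDiv (b : OrthonormalBasis κ ℂ E) (R : Tor N → Fin d → (E →L[ℂ] E)) : Matrix ((Tor N × Fin d) × κ) ((Tor N × Fin d) × κ) ℂ :=
  (matE b (divLinE N R))ᴴ * matE b (divLinE N R)

/-- the Gram matrix is positive semidefinite. [folklore] -/
theorem GmDiv_posSemidef (b : OrthonormalBasis κ ℂ E) (R : Tor N → Fin d → (E →L[ℂ] E)) : (GmDiv N b R).PosSemidef :=
  Matrix.posSemidef_conjTranspose_mul_self _

/-- **`landauG 1 R W = qform (GmDiv b R) (flatE b (uncV W))`** — the Feynman inhabitant IS a PSD matrix form of the flattened field. [folklore] -/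
theorem landauG_one_eq_qformE (b : OrthonormalBasis κ ℂ E) (R : Tor N → Fin d → (E →L[ℂ] E)) (W : Tor N → Fin d → E) :
    landauG N 1 R W = qform (GmDiv N b R) (flatE b (uncV W)) := by
  unfold landauG GmDiv divSq
  rw [inv_one, one_mul, ← sum_norm_sq_eq_qform_gram]
  rfl

end Gram

/-! ## §2 The general-`E` vector END at the Feynman inhabitant with `hREG` discharged -/

section Tower

variable (L : ℕ) [NeZero L] (M : Fin d → ℕ) [hM : ∀ μ, NeZero (M μ)]
variable (R : (k : ℕ) → Tor (fine (L ^ k) M) → Fin d → (E →L[ℂ] E))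
variable (R' : (k : ℕ) → Tor (fine L (fine (L ^ k) M)) → Fin d → (E →L[ℂ] E))
variable (T : (k : ℕ) → Tor M → (Fin d → Fin (L ^ k)) → Fin (L ^ k) → Fin d → (E →L[ℂ] E))
variable (T' : (k : ℕ) → Tor (fine (L ^ k) M) → (Fin d → Fin L) → Fin L → Fin d → (E →L[ℂ] E))

/-- **THE GENERAL-`E` VECTOR END AT THE FEYNMAN INHABITANT, V-REG DISCHARGED**: as `towerLimitRate_effVE_of_leaves` (p222482) with `G k := landauG 1 (R k)`,
`Gm k := GmDiv b (R k)`, `G′ k` the pullback of `G (k+1)` along `sites`, `ρV k := rhoV (L^k) M (R k)`, and `hREG k` supplied by `hREG_rhoV` (p223070) for UNITARY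
`R k` with plaquette defects `p_k` in the class `p_k·(L^k)² ≤ c_p` and CONTRACTIVE line transports `T k`; `C_R⋆ := 4Λ⋆ + 2d·c_p + 7d²c_p²·C_P⋆`.  The other
leaves stay DISPLAYED verbatim.  Nothing of NE3. [folklore] -/
theorem towerLimitRate_effVE_of_leaves_feynman [FiniteDimensional ℂ E] (b : OrthonormalBasis κ ℂ E)
    (hU : ∀ k x μ, R k x μ ∈ unitary (E →L[ℂ] E)) (p : ℕ → ℝ) (hp : ∀ k, 0 ≤ p k)
    (hP : ∀ k x μ ν, ‖R k x μ * R k (x + unitVec (fine (L ^ k) M) μ) ν - R k x ν * R k (x + unitVec (fine (L ^ k) M) ν) μ‖ ≤ p k)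
    {cp : ℝ} (hcp : ∀ k, p k * (((L ^ k : ℕ)) : ℝ) ^ 2 ≤ cp) (hT1 : ∀ k y j t μ, ‖T k y j t μ‖ ≤ 1)
    (hTcomp : ∀ k, T (k + 1) = compL (L ^ k) L M (T k) (T' k)) (hRtr : ∀ k, R (k + 1) = Rtrv (L ^ k) L M (R' k))
    (hsurj₁ : ∀ k, Function.Surjective (QvL L (fine (L ^ k) M) (T' k)))
    {a : ℝ} (ha : 0 < a)
    (Λ CP δ ε₁ δ' : ℕ → ℝ) {Λs CPs cδ cε cδ' θ : ℝ}
    (hΛ : ∀ k, 0 ≤ Λ k) (hΛs : ∀ k, Λ k ≤ Λs) (hCP : ∀ k, 0 ≤ CP k) (hCPs : ∀ k, CP k ≤ CPs)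
    (hδ : ∀ k, 0 ≤ δ k) (hε₁ : ∀ k, 0 ≤ ε₁ k) (hδ' : ∀ k, 0 ≤ δ' k) (hθ : 0 ≤ θ) (hθ1 : θ < 1)
    (hδθ : ∀ k, δ k ≤ cδ * θ ^ k) (hεθ : ∀ k, ε₁ k ≤ cε * θ ^ k) (hδ'θ : ∀ k, δ' k ≤ cδ' * θ ^ k)
    -- leaf V-UB at both levels (displayed)
    (hUBc : ∀ k (φ : Tor M → Fin d → E), ∃ W, QvL (L ^ k) M (T k) W = φ ∧ ScV (L ^ k) M (R k) (landauG (fine (L ^ k) M) 1 (R k)) W ≤ Λ k * nsqV M φ)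
    (hUBf : ∀ k (φ : Tor M → Fin d → E), ∃ W', QvL (L ^ k) M (T k) (QvL L (fine (L ^ k) M) (T' k) W') = φ ∧
      SfV (L ^ k) L M (R' k) (fun W' => landauG (fine (L ^ (k + 1)) M) 1 (R (k + 1)) (W' ∘ sites (L ^ k) L M)) W' ≤ Λ k * nsqV M φ)
    -- leaf V-P at both levels (displayed)
    (hPc : ∀ k W, qWV (L ^ k) M W ≤ CP k * (ScV (L ^ k) M (R k) (landauG (fine (L ^ k) M) 1 (R k)) W + nsqV M (QvL (L ^ k) M (T k) W)))
    (hPf : ∀ k W', qVV (L ^ k) L M W' ≤ CP k * (SfV (L ^ k) L M (R' k) (fun W' => landauG (fine (L ^ (k + 1)) M) 1 (R (k + 1)) (W' ∘ sites (L ^ k) L M)) W'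
      + nsqV M (QvL (L ^ k) M (T k) (QvL L (fine (L ^ k) M) (T' k) W'))))
    -- leaf V-FED (displayed)
    (hFED : ∀ k W', ScV (L ^ k) M (R k) (landauG (fine (L ^ k) M) 1 (R k)) (QvL L (fine (L ^ k) M) (T' k) W')
      ≤ (Real.sqrt (SfV (L ^ k) L M (R' k) (fun W' => landauG (fine (L ^ (k + 1)) M) 1 (R (k + 1)) (W' ∘ sites (L ^ k) L M)) W')
          + δ k * Real.sqrt (qVV (L ^ k) L M W')) ^ 2)
    -- leaf V-ONE (square-root shape, displayed) for `ρV := rhoV`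
    (hONE : ∀ k W, blockSpin (QvL L (fine (L ^ k) M) (T' k)) (SfV (L ^ k) L M (R' k) (fun W' => landauG (fine (L ^ (k + 1)) M) 1 (R (k + 1)) (W' ∘ sites (L ^ k) L M))) W
      ≤ (Real.sqrt (ScV (L ^ k) M (R k) (landauG (fine (L ^ k) M) 1 (R k)) W + ε₁ k * rhoV (L ^ k) M (R k) W) + δ' k * Real.sqrt (qWV (L ^ k) M W)) ^ 2) :
    TowerLimitRate (ι := fun _ => (Tor M × Fin d) × κ) (fun _ => (1 : Matrix ((Tor M × Fin d) × κ) ((Tor M × Fin d) × κ) ℂ)) 1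
      (fun k => effVE (L ^ k) M (R k) (GmDiv (fine (L ^ k) M) b (R k)) (T k) b a)
      (eV Λs CPs cδ + ePV Λs CPs (4 * Λs + 2 * d * cp + 7 * (d : ℝ) ^ 2 * cp ^ 2 * CPs) cε cδ') θ := by
  have hd : (0 : ℝ) ≤ d := Nat.cast_nonneg d
  have hα0 : ∀ k, 0 ≤ p k * (((L ^ k : ℕ)) : ℝ) ^ 2 := fun k => by have := hp k; positivity
  have hcp0 : 0 ≤ cp := (hα0 0).trans (hcp 0)
  have hCPs0 : 0 ≤ CPs := (hCP 0).trans (hCPs 0)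
  -- the REG constants and their uniform bound
  have hCR0 : ∀ k, 0 ≤ 4 * Λ k + 2 * d * (p k * (((L ^ k : ℕ)) : ℝ) ^ 2) + 7 * (d : ℝ) ^ 2 * (p k * (((L ^ k : ℕ)) : ℝ) ^ 2) ^ 2 * CP k :=
    fun k => by have := hΛ k; have := hα0 k; have := hCP k; positivity
  have hCRs : ∀ k, 4 * Λ k + 2 * d * (p k * (((L ^ k : ℕ)) : ℝ) ^ 2) + 7 * (d : ℝ) ^ 2 * (p k * (((L ^ k : ℕ)) : ℝ) ^ 2) ^ 2 * CP k
      ≤ 4 * Λs + 2 * d * cp + 7 * (d : ℝ) ^ 2 * cp ^ 2 * CPs := fun k => by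
    have h1 : (p k * (((L ^ k : ℕ)) : ℝ) ^ 2) ^ 2 ≤ cp ^ 2 := pow_le_pow_left₀ (hα0 k) (hcp k) 2
    have h2 : (p k * (((L ^ k : ℕ)) : ℝ) ^ 2) ^ 2 * CP k ≤ cp ^ 2 * CPs := mul_le_mul h1 (hCPs k) (hCP k) (sq_nonneg _)
    nlinarith [hΛs k, hcp k, mul_le_mul_of_nonneg_left h2 (by positivity : (0 : ℝ) ≤ 7 * (d : ℝ) ^ 2)]
  refine towerLimitRate_effVE_of_leaves L M R R' (fun k => GmDiv (fine (L ^ k) M) b (R k)) (fun k => landauG (fine (L ^ k) M) 1 (R k))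
    (fun k => fun W' => landauG (fine (L ^ (k + 1)) M) 1 (R (k + 1)) (W' ∘ sites (L ^ k) L M)) T T' b
    (fun k => GmDiv_posSemidef (fine (L ^ k) M) b (R k)) (fun k W => landauG_one_eq_qformE (fine (L ^ k) M) b (R k) W) hTcomp hRtr
    (fun k => (Gtr_pullback (L ^ k) L M (landauG (fine (L ^ (k + 1)) M) 1 (R (k + 1)))).symm) hsurj₁ ha Λ CP
    (fun k => 4 * Λ k + 2 * d * (p k * (((L ^ k : ℕ)) : ℝ) ^ 2) + 7 * (d : ℝ) ^ 2 * (p k * (((L ^ k : ℕ)) : ℝ) ^ 2) ^ 2 * CP k) δ ε₁ δ'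
    hΛ hΛs hCP hCPs hCR0 hCRs hδ hε₁ hδ' hθ hθ1 hδθ hεθ hδ'θ (fun k W => rhoV_nonneg (L ^ k) M (R k) W) hUBc hUBf hPc hPf hFED hONE
    fun k φ W hW hmin => ?_
  exact hREG_rhoV (L ^ k) M (hT1 k) (hU k) (hp k) (hP k) (hΛ k) (hUBc k) (hPc k) φ W hW hmin

end Tower

end Summit.QuantumFields.BalabanUV.T4Continuum.VariationalVectorFeynmanEnd

end
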